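import Literature.NumberTheory.ConnesConsani2023.ZetaCyclesSpectralTriple
import Literature.Analysis.UnboundedOperators.DiagonalOperatorCompact
import Literature.NumberTheory.LFunctions.YoshidaWindowFourierSeries
import HarnessLib

/-!
# Connes–Consani ζ-cycles, Prop. 4.1 — proofs: `(𝒜(λ), ℋ(λ), D(λ,k))` is a spectral triple

LABEL (line 1): **RH-FREE corpus literature (discharge file).** Sibling proof file of
`Literature/NumberTheory/ConnesConsani2023/ZetaCyclesSpectralTriple.lean`, which types §4–§5 of
A. Connes, C. Consani, *Spectral triples and ζ-cycles*, Enseign. Math. 69 (2023) 93–148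
(arXiv:2106.01715) and records **Proposition 4.1** ("The operator `D(λ,k)`, combined with the action
of periodic functions by multiplication in `L²([−L/2,L/2])` defines a spectral triple", p0013:L15) as
the named fact `ConnesConsani2023_prop_4_1 := ∀ L U hU, IsSmoothSpectralTriple (diracD L U hU)`, the
conjunction of three clauses. This file PROVES all three clauses for every finite-dimensional
`U ≤ dom D₀`, and hence DISCHARGES the fact (`ConnesConsani2023_prop_4_1_holds`), following the
printed proof (p0013:L17: "`D(λ,k)` is a finite rank perturbation of
`D₀(λ)`, thus by the Kato–Rellich theorem … self-adjoint … The domain of `D(λ,k)` is the same as the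
domain of `D₀(λ)`"):

* `isSelfAdjoint_diracD` — **`D(λ,k) = (1 − Π)D₀(1 − Π)` is self-adjoint on `dom D₀`**: the
  perturbation `B = D(λ,k) − D₀ = −ΠD₀ − D₀Π + ΠD₀Π` is bounded on `dom D₀`
  (`exists_norm_diracD_sub_diracD0_le`, `‖Bf‖ ≤ 3M‖f‖` with `M = ‖D₀|_U‖`, using the symmetry of
  `D₀` to bound `ΠD₀`), and a bounded symmetric perturbation of a self-adjoint operator is
  self-adjoint (`isSelfAdjoint_mk_of_sub_le`, the bounded case of Kato–Rellich, Kato V §4.1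
  Thm 4.3: `T ≤ T†` by symmetry and `dom T† ≤ dom A† = dom A` since `x ↦ ⟪y, (T − A)x⟫` is bounded).
* `hasCompactResolvent_diracD` — **`D(λ,k)` has compact resolvent**: `(D₀ − i)⁻¹` is the diagonal
  operator with symbol `(2πj/L − i)⁻¹ → 0`, compact by the tree's
  `HilbertBasis.isCompactOperator_diagonalCLM_of_tendsto_zero` (`exists_resolvent_diracD0`); the
  correction `K = B(D₀ − i)⁻¹` is bounded of finite rank (`range B ⊆ U + D₀(U)`,
  `diracD_sub_diracD0_mem` — the printed "finite rank perturbation"); `1 + K` is injective because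
  `D(λ,k)` is symmetric (`(D − i)f = 0 ⇒ f = 0`) and surjective by the finite-rank Fredholm
  alternative (solve in `range K`), so `(D(λ,k) − i)⁻¹ = (D₀ − i)⁻¹(1 + K)⁻¹` is compact (Banach
  isomorphism theorem for `(1 + K)⁻¹`, Mathlib's `ContinuousLinearEquiv.ofBijective`).
* `hasBoundedCommutator_diracD` — **bounded commutators** `[D(λ,k), a]`, `a ∈ 𝒜(λ) = C^∞(S¹_L)`
  ("follows from the boundedness of the perturbation"): `[D(λ,k), M_a] = [D₀, M_a] + [B, M_a]` with
  `B` bounded; and `M_a` preserves `dom D₀ = H¹(S¹_L)` with `[D₀, M_a] = Σ_m â(m)(2πm/L) M_{e_m}`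
  (`= M_{−ia′}`) of norm `≤ Σ_m |2πm/L| |â(m)|` (`mulCLM_mem_domain_and_commutator`,
  `norm_diracD0_commutator_le`). Proof: the Leibniz rule for characters
  `D₀(e_m f) = e_m D₀ f + (2πm/L) e_m f` (`diracD0_mulCLM_fourier`, a coefficient shift), the
  uniformly convergent Fourier series `a = Σ â(m) e_m` of a smooth `a` (Mathlib's
  `hasSum_fourier_series_of_summable`; the weighted summability `Σ |m|^j |â(m)| < ∞` is Yoshida's
  (3.1), imported from the tree's `Yoshida1992.summable_pow_mul_norm_fourierCoeff` through the
  window lift of `a`), and the CLOSEDNESS of the self-adjoint `D₀` (Mathlib's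
  `IsSelfAdjoint.isClosed`): the partial sums of `(M_a f, M_a D₀ f + Σ â(m)(2πm/L) e_m f)` lie in the
  graph of `D₀`.
* `isSmoothSpectralTriple_diracD` and the DISCHARGE `ConnesConsani2023_prop_4_1_holds`.

No definitions, no named facts. Nothing here bears on the truth of RH.

## References

* [ConnesConsani2023] A. Connes, C. Consani, *Spectral triples and ζ-cycles*, Enseign. Math. 69
  (2023), Prop. 4.1 and its proof (arXiv:2106.01715 chunk p0013:L15–L17).
* [Kato1966] T. Kato, *Perturbation Theory for Linear Operators*, V §4.1 Thm 4.3 (Kato–Rellich;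
  bounded symmetric perturbations).
* [ReedSimonI1980] M. Reed, B. Simon, *Methods of Modern Mathematical Physics I*, §VIII.3 Prop. 1,
  Thm. VIII.2; Thm. VI.12–VI.13 (norm limits of finite rank operators are compact) — via the
  tree's `DiagonalOperator*.lean`.
* [Yoshida1992HermitianForms] H. Yoshida, *On Hermitian forms attached to zeta functions*, Adv. Stud.
  Pure Math. 21 (1992), §3 p. 289–290, (3.1) (decay of the Fourier coefficients of a smooth periodic
  function) — via the tree's `YoshidaWindowFourierSeries.lean`.
-/

noncomputable section

open MeasureTheory Complex Filter
open scoped InnerProductSpace ComplexConjugate ENNReal Topology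

namespace Literature.NumberTheory.ConnesConsani2023

namespace ZetaCycles

open _root_.AddCircle LinearPMap

section KatoRellich

variable {𝕜 : Type*} [RCLike 𝕜] {E : Type*} [NormedAddCommGroup E] [InnerProductSpace 𝕜 E]
  [CompleteSpace E]

/-- **Bounded symmetric perturbations preserve self-adjointness** (the bounded case of the
Kato–Rellich theorem): if `A` is self-adjoint and `T : dom A → E` is symmetric with
`‖T x − A x‖ ≤ C ‖x‖` on `dom A`, then the operator `T` with domain `dom A` is self-adjoint
(`T ≤ T†` by symmetry; `dom T† ≤ dom A† = dom A` because `x ↦ ⟪y, (T − A) x⟫` is bounded).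
[cite: Kato1966, V §4.1 Thm 4.3] -/
theorem isSelfAdjoint_mk_of_sub_le {A : E →ₗ.[𝕜] E} (hA : IsSelfAdjoint A)
    (T : A.domain →ₗ[𝕜] E) (hT : (LinearPMap.mk A.domain T).IsSymmetric) {C : ℝ}
    (hC : ∀ x : A.domain, ‖T x - A x‖ ≤ C * ‖(x : E)‖) :
    IsSelfAdjoint (LinearPMap.mk A.domain T : E →ₗ.[𝕜] E) := by
  set T' : E →ₗ.[𝕜] E := LinearPMap.mk A.domain T with hT'
  have hdense : Dense (T'.domain : Set E) := hA.dense_domain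
  have hle : T' ≤ T'† := LinearPMap.IsFormalAdjoint.le_adjoint hdense hT
  have hAdom : A†.domain = A.domain := by
    rw [LinearPMap.isSelfAdjoint_def.mp hA]
  have hdom : T'†.domain ≤ T'.domain := by
    intro y hy
    rw [LinearPMap.mem_adjoint_domain_iff] at hy
    -- `x ↦ ⟪y, (T - A) x⟫` is bounded, hence continuous
    have hB : Continuous ((innerₛₗ 𝕜 y).comp (T - A.toFun)) := by
      refine (LinearMap.mkContinuous ((innerₛₗ 𝕜 y).comp (T - A.toFun)) (‖y‖ * C) fun x => ?_).continuous
      simp only [LinearMap.coe_comp, Function.comp_apply, LinearMap.sub_apply, innerₛₗ_apply_apply]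
      calc ‖⟪y, T x - A x⟫_𝕜‖ ≤ ‖y‖ * ‖T x - A x‖ := norm_inner_le_norm _ _
        _ ≤ ‖y‖ * (C * ‖(x : E)‖) := by gcongr; exact hC x
        _ = ‖y‖ * C * ‖x‖ := by rw [mul_assoc]; rfl
    have hAcont : Continuous ((innerₛₗ 𝕜 y).comp A.toFun) := by
      have : (innerₛₗ 𝕜 y).comp A.toFun = (innerₛₗ 𝕜 y).comp T - (innerₛₗ 𝕜 y).comp (T - A.toFun) := by
        ext x
        simp [inner_sub_right]
      rw [this]
      exact hy.sub hB
    have hyA : y ∈ A†.domain := (LinearPMap.mem_adjoint_domain_iff A y).mpr hAcont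
    rw [hAdom] at hyA
    exact hyA
  have heq : T'.domain = T'†.domain := le_antisymm hle.1 hdom
  rw [LinearPMap.isSelfAdjoint_def]
  exact (LinearPMap.eq_of_le_of_domain_eq hle heq).symm

end KatoRellich

variable {L : ℝ} [hL : Fact (0 < L)]

section Perturbed

variable (U : Submodule ℂ (circleL2 L)) [FiniteDimensional ℂ U]

/-- `D₀` restricted to the finite-dimensional `U ≤ dom D₀` is bounded: there is `M ≥ 0` with
`‖D₀ u‖ ≤ M ‖u‖` for `u ∈ U`. [folklore] -/
private theorem exists_norm_diracD0_le_of_mem (hU : U ≤ (diracD0 L).domain) :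
    ∃ M : ℝ, 0 ≤ M ∧ ∀ (u : circleL2 L) (hu : u ∈ U), ‖diracD0 L ⟨u, hU hu⟩‖ ≤ M * ‖u‖ := by
  let T : U →ₗ[ℂ] circleL2 L := (diracD0 L).toFun ∘ₗ Submodule.inclusion hU
  let T' : U →L[ℂ] circleL2 L := LinearMap.toContinuousLinearMap T
  refine ⟨‖T'‖, ContinuousLinearMap.opNorm_nonneg T', fun u hu => ?_⟩
  have h := T'.le_opNorm ⟨u, hu⟩
  exact h

/-- "The boundedness of the perturbation": `B = D(λ,k) − D₀(λ) = −ΠD₀ − D₀Π + ΠD₀Π` satisfies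
`‖B f‖ ≤ C ‖f‖` on `dom D₀` (with `C = 3‖D₀|_U‖`; the term `ΠD₀` is bounded because `D₀` is
symmetric and `range Π ⊆ dom D₀`). [cite: ConnesConsani2023, proof of Prop. 4.1 (arXiv chunk p0013:L17)] -/
theorem exists_norm_diracD_sub_diracD0_le (hU : U ≤ (diracD0 L).domain) :
    ∃ C : ℝ, 0 ≤ C ∧
      ∀ f : (diracD0 L).domain, ‖diracD L U hU f - diracD0 L f‖ ≤ C * ‖(f : circleL2 L)‖ := by
  obtain ⟨M, hM0, hM⟩ := exists_norm_diracD0_le_of_mem U hU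
  refine ⟨3 * M, by positivity, fun f => ?_⟩
  -- the three terms of the expansion
  have hPf : U.starProjection (f : circleL2 L) ∈ U := U.starProjection_apply_mem _
  have h1 : ‖U.starProjection (diracD0 L f)‖ ≤ M * ‖(f : circleL2 L)‖ := by
    set p := U.starProjection (diracD0 L f) with hp
    have hpU : p ∈ U := U.starProjection_apply_mem _
    have hsq : ‖p‖ ^ 2 ≤ M * ‖p‖ * ‖(f : circleL2 L)‖ := by
      have e1 : (‖p‖ ^ 2 : ℝ) = RCLike.re ⟪p, diracD0 L f⟫_ℂ := by
        rw [hp]; exact (U.re_inner_starProjection_eq_normSq _).symm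
      have e2 : ⟪p, diracD0 L f⟫_ℂ = ⟪diracD0 L ⟨p, hU hpU⟩, (f : circleL2 L)⟫_ℂ := by
        have := isSymmetric_diracD0 (L := L) ⟨p, hU hpU⟩ f
        exact this.symm
      rw [e1, e2]
      calc RCLike.re ⟪diracD0 L ⟨p, hU hpU⟩, (f : circleL2 L)⟫_ℂ
          ≤ ‖⟪diracD0 L ⟨p, hU hpU⟩, (f : circleL2 L)⟫_ℂ‖ := RCLike.re_le_norm _
        _ ≤ ‖diracD0 L ⟨p, hU hpU⟩‖ * ‖(f : circleL2 L)‖ := norm_inner_le_norm _ _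
        _ ≤ M * ‖p‖ * ‖(f : circleL2 L)‖ := by gcongr; exact hM p hpU
    by_cases hp0 : ‖p‖ = 0
    · rw [hp0]; positivity
    · have hppos : 0 < ‖p‖ := (norm_nonneg _).lt_of_ne (Ne.symm hp0)
      have : ‖p‖ * ‖p‖ ≤ (M * ‖(f : circleL2 L)‖) * ‖p‖ := by nlinarith [hsq]
      exact le_of_mul_le_mul_right this hppos
  have h2 : ‖diracD0 L ⟨U.starProjection f, hU hPf⟩‖ ≤ M * ‖(f : circleL2 L)‖ :=
    (hM _ hPf).trans (mul_le_mul_of_nonneg_left (U.norm_starProjection_apply_le _) hM0)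
  have h3 : ‖U.starProjection (diracD0 L ⟨U.starProjection f, hU hPf⟩)‖ ≤ M * ‖(f : circleL2 L)‖ :=
    (U.norm_starProjection_apply_le _).trans h2
  rw [diracD_apply_eq_expand]
  calc ‖diracD0 L f - U.starProjection (diracD0 L f) - diracD0 L ⟨U.starProjection f, hU hPf⟩ +
        U.starProjection (diracD0 L ⟨U.starProjection f, hU hPf⟩) - diracD0 L f‖
      = ‖-U.starProjection (diracD0 L f) - diracD0 L ⟨U.starProjection f, hU hPf⟩ +
        U.starProjection (diracD0 L ⟨U.starProjection f, hU hPf⟩)‖ := by congr 1; abel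
    _ ≤ ‖-U.starProjection (diracD0 L f) - diracD0 L ⟨U.starProjection f, hU hPf⟩‖ +
        ‖U.starProjection (diracD0 L ⟨U.starProjection f, hU hPf⟩)‖ := norm_add_le _ _
    _ ≤ (‖-U.starProjection (diracD0 L f)‖ + ‖diracD0 L ⟨U.starProjection f, hU hPf⟩‖) +
        ‖U.starProjection (diracD0 L ⟨U.starProjection f, hU hPf⟩)‖ := by
          gcongr; exact norm_sub_le _ _
    _ ≤ (M * ‖(f : circleL2 L)‖ + M * ‖(f : circleL2 L)‖) + M * ‖(f : circleL2 L)‖ := by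
          rw [norm_neg]; gcongr
    _ = 3 * M * ‖(f : circleL2 L)‖ := by ring

/-! #### The resolvent of `D₀` at `i` -/

omit [FiniteDimensional ℂ U] in
/-- Coefficientwise form of `D₀ f − i f`: `((2πj/L) − i) f̂(j)`. [folklore] -/
private theorem repr_diracD0_sub_I_smul (f : (diracD0 L).domain) (j : ℤ) :
    (fourierBasis (T := L)).repr (diracD0 L f - I • (f : circleL2 L)) j =
      (diracSymbol L j - I) * (fourierBasis (T := L)).repr (f : circleL2 L) j := by
  rw [_root_.map_sub, _root_.map_smul, lp.coeFn_sub, Pi.sub_apply, lp.coeFn_smul, Pi.smul_apply,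
    repr_diracD0_apply, smul_eq_mul]
  ring

omit hL in
/-- `|2πj/L − i| ≥ 1`. [folklore] -/
private theorem one_le_norm_diracSymbol_sub_I (j : ℤ) : 1 ≤ ‖diracSymbol L j - I‖ := by
  have h : (diracSymbol L j - I).im = -1 := by simp [diracSymbol]
  have := Complex.abs_im_le_norm (diracSymbol L j - I)
  rw [h] at this
  simpa using this

omit hL in
/-- `2πj/L − i ≠ 0`. [folklore] -/
private theorem diracSymbol_sub_I_ne_zero (j : ℤ) : diracSymbol L j - I ≠ 0 := fun h => by
  have := one_le_norm_diracSymbol_sub_I (L := L) j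
  rw [h, norm_zero] at this
  exact absurd this (by norm_num)

omit hL in
/-- `|2πj/L| ≤ |2πj/L − i|`. [folklore] -/
private theorem norm_diracSymbol_le (j : ℤ) : ‖diracSymbol L j‖ ≤ ‖diracSymbol L j - I‖ := by
  have h1 : ‖diracSymbol L j‖ = |(diracSymbol L j - I).re| := by
    simp only [diracSymbol, sub_re, ofReal_re, I_re, sub_zero, Complex.norm_real, Real.norm_eq_abs]
  rw [h1]
  exact Complex.abs_re_le_norm _

/-- The resolvent symbol `(2πj/L − i)⁻¹` tends to `0` along the integers. [folklore] -/
private theorem tendsto_norm_inv_diracSymbol_sub_I :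
    Tendsto (fun j : ℤ => ‖(diracSymbol L j - I)⁻¹‖) cofinite (𝓝 0) := by
  have hL0 : 0 < L := hL.out
  -- `‖2πj/L‖ → ∞`
  have h1 : Tendsto (fun j : ℤ => ‖diracSymbol L j‖) cofinite atTop := by
    have hc : Tendsto (fun j : ℤ => ‖(j : ℝ)‖) cofinite atTop :=
      tendsto_norm_cocompact_atTop.comp Int.tendsto_coe_cofinite
    have : (fun j : ℤ => ‖diracSymbol L j‖) = fun j : ℤ => (2 * Real.pi / L) * ‖(j : ℝ)‖ := by
      funext j
      simp only [diracSymbol, Complex.norm_real, Real.norm_eq_abs]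
      rw [show 2 * Real.pi * (j : ℝ) / L = (2 * Real.pi / L) * j by ring, abs_mul,
        abs_of_pos (by positivity)]
    rw [this]
    exact hc.const_mul_atTop (by positivity)
  have h2 : Tendsto (fun j : ℤ => ‖diracSymbol L j - I‖) cofinite atTop :=
    tendsto_atTop_mono (fun j => norm_diracSymbol_le j) h1
  have h3 := h2.inv_tendsto_atTop
  refine h3.congr fun j => ?_
  simp only [Pi.inv_apply, norm_inv]

/-- **The resolvent `(D₀ − i)⁻¹` of the standard Dirac operator**: a compact operator `R₀` of norm
`≤ 1`, mapping `ℋ(λ)` into `dom D₀`, two-sided inverse of `D₀ − i` — the diagonal operator with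
symbol `(2πj/L − i)⁻¹ → 0` (Reed–Simon I §VIII.3 Prop. 1 / Thm. VIII.2; compact by Thm. VI.12–13 via
`HilbertBasis.isCompactOperator_diagonalCLM_of_tendsto_zero`). This is clause (ii) of Prop. 4.1 for
`Π = 0`. [cite: ConnesConsani2023, Prop. 4.1 (arXiv chunk p0013:L15)] -/
theorem exists_resolvent_diracD0 :
    ∃ R : circleL2 L →L[ℂ] circleL2 L, IsCompactOperator R ∧ ‖R‖ ≤ 1 ∧
      (∀ g : circleL2 L, ∃ h : R g ∈ (diracD0 L).domain,
        diracD0 L ⟨R g, h⟩ - I • R g = g) ∧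
      ∀ f : (diracD0 L).domain, R (diracD0 L f - I • (f : circleL2 L)) = f := by
  set b := fourierBasis (T := L) with hb
  set r : ℤ → ℂ := fun j => (diracSymbol L j - I)⁻¹ with hr
  have hr1 : ∀ j, ‖r j‖ ≤ 1 := fun j => by
    rw [hr, norm_inv]
    exact inv_le_one_of_one_le₀ (one_le_norm_diracSymbol_sub_I j)
  have hrmem : Memℓp r ∞ := memℓp_infty ⟨1, by rintro _ ⟨j, rfl⟩; exact hr1 j⟩
  obtain ⟨rl, hrl⟩ : ∃ rl : lp (fun _ : ℤ => ℂ) ∞, ∀ j, rl j = r j := ⟨⟨r, hrmem⟩, fun _ => rfl⟩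
  -- symbol of `D₀ ∘ R₀` is bounded
  have hmr : Memℓp (fun j => diracSymbol L j * r j) ∞ := by
    refine memℓp_infty ⟨1, ?_⟩
    rintro _ ⟨j, rfl⟩
    dsimp only
    rw [norm_mul, hr, norm_inv]
    have h0 : 0 < ‖diracSymbol L j - I‖ := lt_of_lt_of_le one_pos (one_le_norm_diracSymbol_sub_I j)
    rw [mul_inv_le_iff₀ h0, one_mul]
    exact norm_diracSymbol_le j
  have hcoord : ∀ (v : circleL2 L) (j : ℤ), b.repr (b.diagonalCLM rl v) j = r j * b.repr v j :=
    fun v j => by rw [b.diagonalCLM_apply_repr, hrl]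
  have hdom : ∀ v : circleL2 L, b.diagonalCLM rl v ∈ (diracD0 L).domain := fun v => by
    rw [diracD0_domain, HilbertBasis.mem_diagonalDomain_iff]
    have h := hmr.infty_mul_left (lp.memℓp (b.repr v))
    refine (congrArg (Memℓp · 2) (funext fun j => ?_)).mp h
    dsimp only
    rw [hcoord, mul_assoc]
  refine ⟨b.diagonalCLM rl, ?_, ?_, fun g => ⟨hdom g, ?_⟩, fun f => ?_⟩
  · refine b.isCompactOperator_diagonalCLM_of_tendsto_zero rl ?_
    refine (tendsto_norm_inv_diracSymbol_sub_I (L := L)).congr fun j => ?_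
    rw [hrl]
  · refine (b.norm_diagonalCLM_le rl).trans (lp.norm_le_of_forall_le zero_le_one fun j => ?_)
    rw [hrl]; exact hr1 j
  · apply b.repr.injective
    ext j
    rw [repr_diracD0_sub_I_smul]
    change (diracSymbol L j - I) * b.repr (b.diagonalCLM rl g) j = b.repr g j
    rw [hcoord, ← mul_assoc, hr, mul_inv_cancel₀ (diracSymbol_sub_I_ne_zero j), one_mul]
  · apply b.repr.injective
    ext j
    rw [hcoord]
    change r j * b.repr (diracD0 L f - I • (f : circleL2 L)) j = b.repr (f : circleL2 L) j
    rw [repr_diracD0_sub_I_smul, ← mul_assoc, hr, inv_mul_cancel₀ (diracSymbol_sub_I_ne_zero j),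
      one_mul]

/-! #### The finite-rank correction and the resolvent of `D(λ,k)` -/

/-- For the symmetric `D = D(λ,k)`: `(D − i) f = 0` forces `f = 0`. [folklore] -/
private theorem eq_zero_of_diracD_sub_I_eq_zero (hU : U ≤ (diracD0 L).domain) {f : (diracD0 L).domain}
    (h : diracD L U hU f - I • (f : circleL2 L) = 0) : (f : circleL2 L) = 0 := by
  have heq : diracD L U hU f = I • (f : circleL2 L) := sub_eq_zero.mp h
  have hsym := (isSymmetric_diracD U hU) f f
  change ⟪diracD L U hU f, (f : circleL2 L)⟫_ℂ = ⟪(f : circleL2 L), diracD L U hU f⟫_ℂ at hsym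
  rw [heq, inner_smul_left, inner_smul_right, Complex.conj_I, inner_self_eq_norm_sq_to_K] at hsym
  have hs : ((‖(f : circleL2 L)‖ : ℂ)) ^ 2 = 0 := by
    have h2 : (2 * I) * ((‖(f : circleL2 L)‖ : ℂ)) ^ 2 = 0 := by linear_combination -hsym
    rcases mul_eq_zero.mp h2 with h3 | h3
    · exact absurd h3 (mul_ne_zero two_ne_zero I_ne_zero)
    · exact h3
  have hn : ‖(f : circleL2 L)‖ = 0 := by exact_mod_cast (pow_eq_zero_iff two_ne_zero).mp hs
  exact norm_eq_zero.mp hn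

/-- "`D(λ,k)` is a finite rank perturbation of the standard Dirac operator `D₀(λ)`": the range of
`D(λ,k) − D₀(λ)` on `dom D₀` lies in the finite-dimensional subspace `U + D₀(U)` (`U = range Π`).
[cite: ConnesConsani2023, §4 ¶1 (arXiv chunk p0013:L9)] -/
theorem diracD_sub_diracD0_mem (hU : U ≤ (diracD0 L).domain) (f : (diracD0 L).domain) :
    diracD L U hU f - diracD0 L f ∈
      U ⊔ LinearMap.range ((diracD0 L).toFun ∘ₗ Submodule.inclusion hU) := by
  have hPf : U.starProjection (f : circleL2 L) ∈ U := U.starProjection_apply_mem _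
  rw [diracD_apply_eq_expand]
  have e : diracD0 L f - U.starProjection (diracD0 L f) -
        diracD0 L ⟨U.starProjection f, hU hPf⟩ +
        U.starProjection (diracD0 L ⟨U.starProjection f, hU hPf⟩) - diracD0 L f =
      (-U.starProjection (diracD0 L f) + U.starProjection (diracD0 L ⟨U.starProjection f, hU hPf⟩))
        - diracD0 L ⟨U.starProjection f, hU hPf⟩ := by abel
  rw [e]
  refine Submodule.sub_mem _ (Submodule.mem_sup_left ?_) (Submodule.mem_sup_right ?_)
  · exact U.add_mem (U.neg_mem (U.starProjection_apply_mem _)) (U.starProjection_apply_mem _)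
  · exact ⟨⟨U.starProjection f, hPf⟩, rfl⟩

/-- **`D(λ,k)` has compact resolvent** — the second clause of Prop. 4.1: `(D(λ,k) − i)⁻¹ =
(D₀ − i)⁻¹ (1 + B (D₀ − i)⁻¹)⁻¹` with `B = D(λ,k) − D₀` bounded of finite rank; `(D₀ − i)⁻¹` is compact
(diagonal with symbol `→ 0`) and `1 + B(D₀ − i)⁻¹` is injective (`D(λ,k)` is symmetric) hence, the
correction having finite rank, invertible. RH-FREE. [cite: ConnesConsani2023, Prop. 4.1 (arXiv chunk p0013:L15–L17)] -/
theorem hasCompactResolvent_diracD (hU : U ≤ (diracD0 L).domain) :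
    HasCompactResolvent (diracD L U hU) := by
  obtain ⟨R₀, hR₀c, -, hR₀a, hR₀b⟩ := exists_resolvent_diracD0 (L := L)
  have hR₀dom : ∀ g : circleL2 L, R₀ g ∈ (diracD0 L).domain := fun g => (hR₀a g).1
  have hR₀inv : ∀ g : circleL2 L, diracD0 L ⟨R₀ g, hR₀dom g⟩ - I • R₀ g = g := fun g => (hR₀a g).2
  obtain ⟨C, hC0, hC⟩ := exists_norm_diracD_sub_diracD0_le U hU
  -- `R₀` with values in the domain
  let R₀' : circleL2 L →ₗ[ℂ] (diracD0 L).domain :=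
    LinearMap.codRestrict (diracD0 L).domain (R₀ : circleL2 L →ₗ[ℂ] circleL2 L) hR₀dom
  have hR₀'val : ∀ g, ((R₀' g : (diracD0 L).domain) : circleL2 L) = R₀ g := fun g => rfl
  have hR₀inv' : ∀ g : circleL2 L, diracD0 L (R₀' g) - I • R₀ g = g := fun g => hR₀inv g
  have hR₀b' : ∀ f : (diracD0 L).domain, R₀' (diracD0 L f - I • (f : circleL2 L)) = f :=
    fun f => Subtype.ext (hR₀b f)
  -- the perturbation `B = D − D₀` on `dom D₀` and the correction `K = B ∘ R₀`
  let B : (diracD0 L).domain →ₗ[ℂ] circleL2 L :=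
    (((1 : circleL2 L →L[ℂ] circleL2 L) - U.starProjection).toLinearMap ∘ₗ
      (diracD0 L).toFun ∘ₗ complProj U hU) - (diracD0 L).toFun
  have hB : ∀ f : (diracD0 L).domain, B f = diracD L U hU f - diracD0 L f := fun f => rfl
  let Kₗ : circleL2 L →ₗ[ℂ] circleL2 L := B ∘ₗ R₀'
  have hKₗ_apply : ∀ g, Kₗ g = diracD L U hU (R₀' g) - diracD0 L (R₀' g) := fun g => rfl
  have hKbound : ∀ g, ‖Kₗ g‖ ≤ C * ‖R₀‖ * ‖g‖ := fun g => by
    rw [hKₗ_apply]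
    calc ‖diracD L U hU (R₀' g) - diracD0 L (R₀' g)‖ ≤ C * ‖R₀ g‖ := hC (R₀' g)
      _ ≤ C * (‖R₀‖ * ‖g‖) := by gcongr; exact R₀.le_opNorm g
      _ = C * ‖R₀‖ * ‖g‖ := by ring
  let K : circleL2 L →L[ℂ] circleL2 L := LinearMap.mkContinuous Kₗ (C * ‖R₀‖) hKbound
  have hKK : ∀ g, K g = Kₗ g := fun g => rfl
  let IK : circleL2 L →L[ℂ] circleL2 L := 1 + K
  have hIK : ∀ x, IK x = x + Kₗ x := fun x => rfl
  -- (a) `D (R₀ g) − i R₀ g = (1 + K) g`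
  have hDa : ∀ g, diracD L U hU (R₀' g) - I • R₀ g = IK g := fun g => by
    rw [hIK, hKₗ_apply]
    calc diracD L U hU (R₀' g) - I • R₀ g
        = (diracD0 L (R₀' g) - I • R₀ g) + (diracD L U hU (R₀' g) - diracD0 L (R₀' g)) := by abel
      _ = g + (diracD L U hU (R₀' g) - diracD0 L (R₀' g)) := by rw [hR₀inv' g]
  -- (b) `D f − i f = (1 + K) (D₀ f − i f)` on the domain
  have hDb : ∀ f : (diracD0 L).domain,
      diracD L U hU f - I • (f : circleL2 L) = IK (diracD0 L f - I • (f : circleL2 L)) :=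
    fun f => by
    rw [hIK, hKₗ_apply, hR₀b']
    abel
  -- `1 + K` is injective (because `D` is symmetric)
  have hinj_fun : ∀ g, IK g = 0 → g = 0 := by
    intro g hg
    have h1 : diracD L U hU (R₀' g) - I • ((R₀' g : (diracD0 L).domain) : circleL2 L) = 0 := by
      rw [hR₀'val, hDa, hg]
    have h2 : R₀ g = 0 := eq_zero_of_diracD_sub_I_eq_zero U hU h1
    have h4 : R₀' g = 0 := Subtype.ext h2
    have h3 := hR₀inv' g
    rw [h4, LinearPMap.map_zero, h2, smul_zero, sub_zero] at h3
    exact h3.symm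
  have hinj : LinearMap.ker (IK : circleL2 L →ₗ[ℂ] circleL2 L) = ⊥ := by
    rw [LinearMap.ker_eq_bot']
    intro g hg
    exact hinj_fun g hg
  -- `K` has finite rank
  have hfin : FiniteDimensional ℂ (LinearMap.range Kₗ) := by
    have hle : LinearMap.range Kₗ ≤
        U ⊔ LinearMap.range ((diracD0 L).toFun ∘ₗ Submodule.inclusion hU) := by
      rintro _ ⟨g, rfl⟩
      rw [hKₗ_apply]
      exact diracD_sub_diracD0_mem U hU (R₀' g)
    exact Submodule.finiteDimensional_of_le hle
  -- `1 + K` is surjective (finite-rank Fredholm alternative)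
  have hsurj : LinearMap.range (IK : circleL2 L →ₗ[ℂ] circleL2 L) = ⊤ := by
    rw [LinearMap.range_eq_top]
    intro y
    set V := LinearMap.range Kₗ with hV
    let S : V →ₗ[ℂ] V :=
      { toFun := fun v => ⟨(v : circleL2 L) + Kₗ v, V.add_mem v.2 (LinearMap.mem_range_self Kₗ _)⟩
        map_add' := fun v w => by
          apply Subtype.ext
          simp only [Submodule.coe_add, _root_.map_add]
          abel
        map_smul' := fun c v => by
          apply Subtype.ext
          simp only [Submodule.coe_smul, _root_.map_smul, RingHom.id_apply, smul_add] }
    have hSinj : Function.Injective S := by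
      intro v w hvw
      have h1 : (v : circleL2 L) + Kₗ v = w + Kₗ w := congrArg Subtype.val hvw
      have h2 : IK ((v : circleL2 L) - w) = 0 := by
        rw [hIK, _root_.map_sub]
        calc (v : circleL2 L) - w + (Kₗ v - Kₗ w) = ((v : circleL2 L) + Kₗ v) - (w + Kₗ w) := by abel
          _ = 0 := sub_eq_zero.mpr h1
      exact Subtype.ext (sub_eq_zero.mp (hinj_fun _ h2))
    obtain ⟨v, hv⟩ := LinearMap.surjective_of_injective hSinj
      ⟨-Kₗ y, V.neg_mem (LinearMap.mem_range_self Kₗ y)⟩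
    have hv' : (v : circleL2 L) + Kₗ v = -Kₗ y := congrArg Subtype.val hv
    refine ⟨y + v, ?_⟩
    change IK (y + v) = y
    rw [hIK, _root_.map_add]
    calc y + (v : circleL2 L) + (Kₗ y + Kₗ v) = y + Kₗ y + ((v : circleL2 L) + Kₗ v) := by abel
      _ = y := by rw [hv']; abel
  -- the resolvent `R = R₀ ∘ (1 + K)⁻¹`
  let Φ := ContinuousLinearEquiv.ofBijective IK hinj hsurj
  have hΦ_apply : ∀ x, Φ x = IK x := fun x => rfl
  refine ⟨R₀.comp (Φ.symm : circleL2 L →L[ℂ] circleL2 L), ?_, fun g => ⟨hR₀dom _, ?_⟩, fun f => ?_⟩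
  · exact hR₀c.comp_clm (Φ.symm : circleL2 L →L[ℂ] circleL2 L)
  · change diracD L U hU (R₀' (Φ.symm g)) - I • R₀ (Φ.symm g) = g
    rw [hDa, ← hΦ_apply, ContinuousLinearEquiv.apply_symm_apply]
  · change R₀ (Φ.symm (diracD L U hU f - I • (f : circleL2 L))) = f
    rw [hDb, ← hΦ_apply, ContinuousLinearEquiv.symm_apply_apply]
    exact hR₀b f

/-- **`D(λ,k)` is self-adjoint** on `dom D₀` — the first of the three clauses of Prop. 4.1
(\"by the Kato–Rellich theorem … it is essentially self-adjoint on any core of `D₀(λ)`. The domain of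
`D(λ,k)` is the same as the domain of `D₀(λ)`\"): a bounded symmetric perturbation of the self-adjoint
`D₀`. [cite: ConnesConsani2023, Prop. 4.1 (arXiv chunk p0013:L15–L17)] -/
theorem isSelfAdjoint_diracD (hU : U ≤ (diracD0 L).domain) : IsSelfAdjoint (diracD L U hU) := by
  obtain ⟨C, -, hC⟩ := exists_norm_diracD_sub_diracD0_le U hU
  exact isSelfAdjoint_mk_of_sub_le isSelfAdjoint_diracD0 (diracD L U hU).toFun
    (isSymmetric_diracD U hU) hC


/-- What remains of **Proposition 4.1** after `isSelfAdjoint_diracD` and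
`hasCompactResolvent_diracD`: the spectral-triple property of `(𝒜(λ), ℋ(λ), D(λ,k))` follows from the
third clause alone, the boundedness of the commutators `[D(λ,k), a]`, `a ∈ C^∞(S¹_L)` ("follows from the
boundedness of the perturbation" once `[D₀, a] = −i a′` is known on `dom D₀ = H¹`; not proved here).
[cite: ConnesConsani2023, Prop. 4.1 (arXiv chunk p0013:L15–L17)] -/
theorem isSmoothSpectralTriple_diracD_of_hasBoundedCommutator (hU : U ≤ (diracD0 L).domain)
    (hcomm : ∀ a ∈ smoothCircleAlgebra L, HasBoundedCommutator (diracD L U hU) a) :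
    IsSmoothSpectralTriple (diracD L U hU) :=
  ⟨isSelfAdjoint_diracD U hU, hasCompactResolvent_diracD U hU, hcomm⟩

end Perturbed

/-! ### Clause (iii), step 1: the multiplication operators `M_a` and the characters `M_{e_m}` -/

/-- `‖M_a f‖ ≤ ‖a‖_∞ ‖f‖`: the action of `C(S¹_L)` on `ℋ(λ)` by multiplication is bounded.
[cite: ConnesConsani2023, Prop. 4.1 (arXiv chunk p0013:L15)] -/
theorem norm_mulCLM_apply_le (a : C(AddCircle L, ℂ)) (f : circleL2 L) :
    ‖mulCLM a f‖ ≤ ‖a‖ * ‖f‖ := by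
  refine Lp.norm_le_mul_norm_of_ae_le_mul ?_
  filter_upwards [coeFn_mulCLM a f] with x hx
  rw [hx, norm_mul]
  exact mul_le_mul_of_nonneg_right (a.norm_coe_le_norm x) (norm_nonneg _)

/-- `M_{a + a'} = M_a + M_{a'}` pointwise. [folklore] -/
private theorem mulCLM_add_apply (a a' : C(AddCircle L, ℂ)) (f : circleL2 L) :
    mulCLM (a + a') f = mulCLM a f + mulCLM a' f := by
  apply Lp.ext
  filter_upwards [coeFn_mulCLM (a + a') f, coeFn_mulCLM a f, coeFn_mulCLM a' f,
    Lp.coeFn_add (mulCLM a f) (mulCLM a' f)] with x h1 h2 h3 h4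
  rw [h1, h4, Pi.add_apply, h2, h3, ContinuousMap.add_apply, add_mul]

/-- `M_{c a} = c M_a` pointwise. [folklore] -/
private theorem mulCLM_smul_apply (c : ℂ) (a : C(AddCircle L, ℂ)) (f : circleL2 L) :
    mulCLM (c • a) f = c • mulCLM a f := by
  apply Lp.ext
  filter_upwards [coeFn_mulCLM (c • a) f, coeFn_mulCLM a f,
    Lp.coeFn_smul c (mulCLM a f)] with x h1 h2 h3
  rw [h1, h3, Pi.smul_apply, h2, ContinuousMap.smul_apply, smul_eq_mul, smul_eq_mul, mul_assoc]

/-- `a ↦ M_a f` as a bounded linear map `C(S¹_L) → L²`. [folklore] -/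
private theorem exists_mulCLM_right (f : circleL2 L) :
    ∃ Φ : C(AddCircle L, ℂ) →L[ℂ] circleL2 L, ∀ a, Φ a = mulCLM a f := by
  let Φₗ : C(AddCircle L, ℂ) →ₗ[ℂ] circleL2 L :=
    { toFun := fun a => mulCLM a f
      map_add' := fun a a' => mulCLM_add_apply a a' f
      map_smul' := fun c a => mulCLM_smul_apply c a f }
  refine ⟨LinearMap.mkContinuous Φₗ ‖f‖ fun a => ?_, fun a => rfl⟩
  rw [mul_comm]
  exact norm_mulCLM_apply_le a f

/-- Fourier coefficients of `e_m · f`: `(e_m f)^(j) = f̂(j − m)` (the character `e_m ∈ 𝒜(λ)` shifts the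
spectrum of `D₀`). [cite: ConnesConsani2023, §4 (arXiv chunk p0013:L3–L17)] -/
theorem repr_mulCLM_fourier (m : ℤ) (f : circleL2 L) (j : ℤ) :
    (fourierBasis (T := L)).repr (mulCLM (fourier m) f) j =
      (fourierBasis (T := L)).repr f (j - m) := by
  rw [fourierBasis_repr, fourierBasis_repr,
    fourierCoeff_congr_ae (coeFn_mulCLM (fourier m) f)]
  simp only [fourierCoeff, smul_eq_mul]
  refine integral_congr_ae (ae_of_all _ fun x => ?_)
  dsimp only
  rw [← mul_assoc, ← fourier_add]
  congr 2
  ring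

/-- `e_m · f ∈ dom D₀` for `f ∈ dom D₀` (the characters preserve `H¹(S¹_L)`).
[cite: ConnesConsani2023, proof of Prop. 4.1 (arXiv chunk p0013:L17)] -/
theorem mulCLM_fourier_mem_diracD0_domain (m : ℤ) {f : circleL2 L} (hf : f ∈ (diracD0 L).domain) :
    mulCLM (fourier m) f ∈ (diracD0 L).domain := by
  rw [diracD0_domain, HilbertBasis.mem_diagonalDomain_iff] at hf ⊢
  have two : (0 : ℝ) < (2 : ℝ≥0∞).toReal := by norm_num
  -- the shifted sequences
  have hshift : ∀ {g : ℤ → ℂ}, Memℓp g 2 → Memℓp (fun j => g (j - m)) 2 := by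
    intro g hg
    rw [memℓp_gen_iff two] at hg ⊢
    have he : (fun j : ℤ => ‖g (j - m)‖ ^ (2 : ℝ≥0∞).toReal) =
        (fun j : ℤ => ‖g j‖ ^ (2 : ℝ≥0∞).toReal) ∘ (Equiv.subRight m) := by
      funext j; simp only [Function.comp_apply, Equiv.subRight_apply]
    rw [he]
    exact (Equiv.subRight m).summable_iff.mpr hg
  have h1 : Memℓp (fun j : ℤ => diracSymbol L (j - m) *
      (fourierBasis (T := L)).repr f (j - m)) 2 :=
    hshift (g := fun i : ℤ => diracSymbol L i * (fourierBasis (T := L)).repr f i) hf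
  have h2 : Memℓp (fun j : ℤ => diracSymbol L m *
      (fourierBasis (T := L)).repr f (j - m)) 2 :=
    (hshift (g := fun i : ℤ => (fourierBasis (T := L)).repr f i) (lp.memℓp _)).const_mul
      (diracSymbol L m)
  have key : (fun j : ℤ => diracSymbol L j *
      (fourierBasis (T := L)).repr (mulCLM (fourier m) f) j) =
      fun j : ℤ => diracSymbol L (j - m) * (fourierBasis (T := L)).repr f (j - m) +
        diracSymbol L m * (fourierBasis (T := L)).repr f (j - m) := by
    funext j
    rw [repr_mulCLM_fourier]
    have : diracSymbol L j = diracSymbol L (j - m) + diracSymbol L m := by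
      simp only [diracSymbol]; push_cast; ring
    rw [this]; ring
  rw [key]
  exact h1.add h2

/-- Leibniz rule for characters: `D₀(e_m f) = e_m D₀ f + (2πm/L) e_m f`, i.e. `[D₀, e_m] = (2πm/L) e_m =
−i e_m′` — the case `a = e_m` of the bounded commutator. [cite: ConnesConsani2023, proof of Prop. 4.1 (arXiv chunk p0013:L17)] -/
theorem diracD0_mulCLM_fourier (m : ℤ) (f : (diracD0 L).domain) :
    diracD0 L ⟨mulCLM (fourier m) f, mulCLM_fourier_mem_diracD0_domain m f.2⟩ =
      mulCLM (fourier m) (diracD0 L f) + diracSymbol L m • mulCLM (fourier m) (f : circleL2 L) := by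
  apply (fourierBasis (T := L)).repr.injective
  ext j
  rw [repr_diracD0_apply, _root_.map_add, _root_.map_smul, lp.coeFn_add, lp.coeFn_smul,
    Pi.add_apply, Pi.smul_apply, smul_eq_mul]
  change diracSymbol L j * (fourierBasis (T := L)).repr (mulCLM (fourier m) (f : circleL2 L)) j = _
  rw [repr_mulCLM_fourier, repr_mulCLM_fourier, repr_diracD0_apply]
  have : diracSymbol L j = diracSymbol L (j - m) + diracSymbol L m := by
    simp only [diracSymbol]; push_cast; ring
  rw [this]; ring

/-- `‖2πn/L‖ = (2π/L)|n|`. [folklore] -/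
private theorem norm_diracSymbol (n : ℤ) : ‖diracSymbol L n‖ = 2 * Real.pi / L * |(n : ℝ)| := by
  have hL0 := hL.out
  rw [diracSymbol, Complex.norm_real, Real.norm_eq_abs,
    show 2 * Real.pi * (n : ℝ) / L = (2 * Real.pi / L) * n by ring, abs_mul,
    abs_of_pos (by positivity)]

/-! ### Clause (iii), step 2: a smooth `a` has summable weighted Fourier coefficients (Yoshida 1992 (3.1)) -/

omit hL in
open Literature.NumberTheory.LFunctions in
/-- The window truncation of the lift of `a ∈ C^∞(S¹_L)` lies in Yoshida's `K(L/2)` (smooth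
`L`-periodic functions restricted to `[−L/2, L/2]`). [folklore] -/
private theorem windowLift_mem_K {a : C(AddCircle L, ℂ)} (ha : a ∈ smoothCircleAlgebra L) :
    (fun x : ℝ => if |x| ≤ L / 2 then a (x : AddCircle L) else 0) ∈ Yoshida1992.K (L / 2) := by
  refine ⟨fun x => a (x : AddCircle L), ha, ?_, fun x hx => by simp [hx], fun x hx => by
    simp [not_le.mpr hx]⟩
  intro x
  show a (((x + 2 * (L / 2) : ℝ)) : AddCircle L) = a (x : AddCircle L)
  rw [show x + 2 * (L / 2) = x + L by ring, AddCircle.coe_add_period]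

open Literature.NumberTheory.LFunctions in
/-- Mathlib's Fourier coefficient of `a` is `1/L` times Yoshida's window coefficient of its lift:
`â(n) = (1/L) ∫_{−L/2}^{L/2} a(x) e^{−2πinx/L} dx`. [folklore] -/
private theorem fourierCoeff_eq_window (a : C(AddCircle L, ℂ)) (n : ℤ) :
    fourierCoeff (a : AddCircle L → ℂ) n = (1 / L : ℝ) •
      Yoshida1992.fourierCoeff (L / 2) n (fun x : ℝ => if |x| ≤ L / 2 then a (x : AddCircle L) else 0) := by
  rw [fourierCoeff_eq_intervalIntegral _ n (-(L / 2)), Yoshida1992.fourierCoeff,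
    show -(L / 2) + L = L / 2 by ring]
  congr 1
  refine intervalIntegral.integral_congr fun x hx => ?_
  have hL2 : 0 ≤ L / 2 := by have := hL.out; positivity
  rw [Set.uIcc_of_le (by linarith)] at hx
  have hxabs : |x| ≤ L / 2 := abs_le.mpr ⟨by linarith [hx.1], hx.2⟩
  simp only [if_pos hxabs, fourier_coe_apply, smul_eq_mul]
  rw [mul_comm]
  congr 1
  congr 1
  have hL0 : (L : ℂ) ≠ 0 := by exact_mod_cast hL.out.ne'
  push_cast
  field_simp

open Literature.NumberTheory.LFunctions in
/-- For `a ∈ C^∞(S¹_L)`: `Σ_n |n|^j ‖â(n)‖ < ∞` for every `j` — Yoshida's (3.1) "`|c_n| |n|^k → 0` …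
by partial integration" for smooth periodic functions, transported from the window coefficients of
the tree's `Yoshida1992.summable_pow_mul_norm_fourierCoeff`. [cite: Yoshida1992HermitianForms, §3 p. 289–290, (3.1)] -/
theorem summable_pow_mul_norm_fourierCoeff {a : C(AddCircle L, ℂ)} (ha : a ∈ smoothCircleAlgebra L)
    (j : ℕ) : Summable fun n : ℤ => |(n : ℝ)| ^ j * ‖fourierCoeff (a : AddCircle L → ℂ) n‖ := by
  have hL2 : 0 < L / 2 := by have := hL.out; positivity
  have h := (Yoshida1992.summable_pow_mul_norm_fourierCoeff hL2 (windowLift_mem_K ha) j).mul_left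
    (1 / L)
  refine (congrArg Summable (funext fun n => ?_)).mp h
  rw [fourierCoeff_eq_window, norm_smul, Real.norm_of_nonneg (by have := hL.out; positivity)]
  ring

/-- For `a ∈ C^∞(S¹_L)` the Fourier coefficients are absolutely summable (so the Fourier series of `a`
converges uniformly). [cite: Yoshida1992HermitianForms, §3 p. 289–290, (3.1)] -/
theorem summable_norm_fourierCoeff {a : C(AddCircle L, ℂ)} (ha : a ∈ smoothCircleAlgebra L) :
    Summable fun n : ℤ => ‖fourierCoeff (a : AddCircle L → ℂ) n‖ := by
  simpa using summable_pow_mul_norm_fourierCoeff ha 0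

/-- For `a ∈ C^∞(S¹_L)`: `Σ_n |2πn/L| ‖â(n)‖ < ∞` (absolute summability of the coefficients of `a′`).
[cite: Yoshida1992HermitianForms, §3 p. 289–290, (3.1)] -/
theorem summable_norm_diracSymbol_mul_norm_fourierCoeff {a : C(AddCircle L, ℂ)}
    (ha : a ∈ smoothCircleAlgebra L) :
    Summable fun n : ℤ => ‖diracSymbol L n‖ * ‖fourierCoeff (a : AddCircle L → ℂ) n‖ := by
  have h := (summable_pow_mul_norm_fourierCoeff ha 1).mul_left (2 * Real.pi / L)
  refine (congrArg Summable (funext fun n => ?_)).mp h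
  rw [norm_diracSymbol, pow_one]
  ring

/-! ### Clause (iii), step 3: `M_a` preserves `dom D₀` and `[D₀, M_a]` is bounded (`a ∈ C^∞(S¹_L)`) -/

/-- The Fourier series of a smooth `a` acts termwise: `M_a g = Σ_m â(m) e_m g`, norm-convergent in
`ℋ(λ)`. [cite: ConnesConsani2023, proof of Prop. 4.1 (arXiv chunk p0013:L17)] -/
theorem hasSum_mulCLM_fourier {a : C(AddCircle L, ℂ)} (ha : a ∈ smoothCircleAlgebra L)
    (g : circleL2 L) :
    HasSum (fun m : ℤ => fourierCoeff (a : AddCircle L → ℂ) m • mulCLM (fourier m) g)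
      (mulCLM a g) := by
  obtain ⟨Φ, hΦ⟩ := exists_mulCLM_right g
  have h := (hasSum_fourier_series_of_summable
    (Summable.of_norm (summable_norm_fourierCoeff ha))).mapL Φ
  simp only [_root_.map_smul] at h
  simp only [hΦ] at h
  exact h

/-- **`M_a` preserves `dom D₀ = H¹(S¹_L)` and `[D₀, M_a] = Σ_m â(m)(2πm/L) M_{e_m}`** (`= M_{−ia′}`),
for `a ∈ C^∞(S¹_L)` — by the closedness of the self-adjoint `D₀` applied to the partial sums of the
Fourier series of `a`. [cite: ConnesConsani2023, proof of Prop. 4.1 (arXiv chunk p0013:L17)] -/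
theorem mulCLM_mem_domain_and_commutator {a : C(AddCircle L, ℂ)} (ha : a ∈ smoothCircleAlgebra L)
    (f : (diracD0 L).domain) :
    ∃ h : mulCLM a (f : circleL2 L) ∈ (diracD0 L).domain,
      HasSum (fun m : ℤ => (fourierCoeff (a : AddCircle L → ℂ) m * diracSymbol L m) •
          mulCLM (fourier m) (f : circleL2 L))
        (diracD0 L ⟨mulCLM a f, h⟩ - mulCLM a (diracD0 L f)) := by
  set c : ℤ → ℂ := fun m => fourierCoeff (a : AddCircle L → ℂ) m with hc
  -- the three series
  have hS : HasSum (fun m : ℤ => c m • mulCLM (fourier m) (f : circleL2 L)) (mulCLM a f) :=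
    hasSum_mulCLM_fourier ha f
  have hS' : HasSum (fun m : ℤ => c m • mulCLM (fourier m) (diracD0 L f)) (mulCLM a (diracD0 L f)) :=
    hasSum_mulCLM_fourier ha _
  have hWsum : Summable (fun m : ℤ => (c m * diracSymbol L m) • mulCLM (fourier m) (f : circleL2 L)) := by
    refine Summable.of_norm_bounded
      ((summable_norm_diracSymbol_mul_norm_fourierCoeff ha).mul_right ‖(f : circleL2 L)‖) fun m => ?_
    rw [norm_smul, norm_mul]
    calc ‖c m‖ * ‖diracSymbol L m‖ * ‖mulCLM (fourier m) (f : circleL2 L)‖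
        ≤ ‖c m‖ * ‖diracSymbol L m‖ * (‖(fourier m : C(AddCircle L, ℂ))‖ * ‖(f : circleL2 L)‖) := by
          gcongr; exact norm_mulCLM_apply_le _ _
      _ = ‖diracSymbol L m‖ * ‖fourierCoeff (a : AddCircle L → ℂ) m‖ * ‖(f : circleL2 L)‖ := by
          rw [fourier_norm, one_mul, hc]; ring
  obtain ⟨W, hW⟩ := hWsum
  have hT : HasSum (fun m : ℤ => c m • mulCLM (fourier m) (diracD0 L f) +
      (c m * diracSymbol L m) • mulCLM (fourier m) (f : circleL2 L)) (mulCLM a (diracD0 L f) + W) :=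
    hS'.add hW
  -- the pairs lie in the (closed) graph of `D₀`
  have hgraph : ∀ m : ℤ, (c m • mulCLM (fourier m) (f : circleL2 L),
      c m • mulCLM (fourier m) (diracD0 L f) +
        (c m * diracSymbol L m) • mulCLM (fourier m) (f : circleL2 L)) ∈ (diracD0 L).graph := by
    intro m
    have hmem := (diracD0 L).mem_graph ⟨mulCLM (fourier m) f, mulCLM_fourier_mem_diracD0_domain m f.2⟩
    rw [diracD0_mulCLM_fourier] at hmem
    have := (diracD0 L).graph.smul_mem (c m) hmem
    simp only [Prod.smul_mk, smul_add, smul_smul] at this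
    exact this
  have hclosed : IsClosed ((diracD0 L).graph : Set (circleL2 L × circleL2 L)) :=
    (isSelfAdjoint_diracD0 (L := L)).isClosed
  have hlim := hclosed.mem_of_tendsto (hS.prodMk hT)
    (.of_forall fun s => Submodule.sum_mem _ fun m _ => hgraph m)
  rw [SetLike.mem_coe, LinearPMap.mem_graph_iff] at hlim
  obtain ⟨y, hy1, hy2⟩ := hlim
  simp only at hy1 hy2
  have hdom : mulCLM a (f : circleL2 L) ∈ (diracD0 L).domain := by rw [← hy1]; exact y.2
  refine ⟨hdom, ?_⟩
  have hyeq : y = ⟨mulCLM a (f : circleL2 L), hdom⟩ := Subtype.ext hy1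
  rw [hyeq] at hy2
  rw [hy2, add_sub_cancel_left]
  exact hW

/-- Norm bound for the commutator: `‖D₀(M_a f) − M_a(D₀ f)‖ ≤ (Σ_m |2πm/L| ‖â(m)‖) ‖f‖` (`[D₀, a]` is
bounded for the standard Dirac operator). [cite: ConnesConsani2023, proof of Prop. 4.1 (arXiv chunk p0013:L17)] -/
theorem norm_diracD0_commutator_le {a : C(AddCircle L, ℂ)} (ha : a ∈ smoothCircleAlgebra L)
    (f : (diracD0 L).domain) (h : mulCLM a (f : circleL2 L) ∈ (diracD0 L).domain) :
    ‖diracD0 L ⟨mulCLM a f, h⟩ - mulCLM a (diracD0 L f)‖ ≤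
      (∑' m : ℤ, ‖diracSymbol L m‖ * ‖fourierCoeff (a : AddCircle L → ℂ) m‖) * ‖(f : circleL2 L)‖ := by
  obtain ⟨h', hsum⟩ := mulCLM_mem_domain_and_commutator ha f
  have hb : ∀ m : ℤ, ‖(fourierCoeff (a : AddCircle L → ℂ) m * diracSymbol L m) •
      mulCLM (fourier m) (f : circleL2 L)‖ ≤
      ‖diracSymbol L m‖ * ‖fourierCoeff (a : AddCircle L → ℂ) m‖ * ‖(f : circleL2 L)‖ := by
    intro m
    rw [norm_smul, norm_mul]
    calc ‖fourierCoeff (a : AddCircle L → ℂ) m‖ * ‖diracSymbol L m‖ *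
          ‖mulCLM (fourier m) (f : circleL2 L)‖
        ≤ ‖fourierCoeff (a : AddCircle L → ℂ) m‖ * ‖diracSymbol L m‖ *
          (‖(fourier m : C(AddCircle L, ℂ))‖ * ‖(f : circleL2 L)‖) := by
          gcongr; exact norm_mulCLM_apply_le _ _
      _ = ‖diracSymbol L m‖ * ‖fourierCoeff (a : AddCircle L → ℂ) m‖ * ‖(f : circleL2 L)‖ := by
          rw [fourier_norm, one_mul]; ring
  have hle := tsum_of_norm_bounded
    (((summable_norm_diracSymbol_mul_norm_fourierCoeff ha).mul_right ‖(f : circleL2 L)‖).hasSum) hb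
  have hh : (⟨mulCLM a f, h⟩ : (diracD0 L).domain) = ⟨mulCLM a f, h'⟩ := rfl
  rw [hh, ← hsum.tsum_eq, ← tsum_mul_right]
  exact hle

/-! ### Clause (iii) for `D(λ,k)` and the discharge of Prop. 4.1 -/

section PerturbedCommutator

variable (U : Submodule ℂ (circleL2 L)) [FiniteDimensional ℂ U]

/-- **Clause (iii) of Prop. 4.1**: `[D(λ,k), a]` is bounded for every `a ∈ C^∞(S¹_L)` ("the
boundedness of the commutator `[D(λ,k),f]` follows from the boundedness of the perturbation").
[cite: ConnesConsani2023, Prop. 4.1 (arXiv chunk p0013:L15–L17)] -/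
theorem hasBoundedCommutator_diracD (hU : U ≤ (diracD0 L).domain) {a : C(AddCircle L, ℂ)}
    (ha : a ∈ smoothCircleAlgebra L) : HasBoundedCommutator (diracD L U hU) a := by
  obtain ⟨C, hC0, hC⟩ := exists_norm_diracD_sub_diracD0_le U hU
  set A : ℝ := ∑' m : ℤ, ‖diracSymbol L m‖ * ‖fourierCoeff (a : AddCircle L → ℂ) m‖ with hA
  have hdom : ∀ f : (diracD L U hU).domain, mulCLM a (f : circleL2 L) ∈ (diracD L U hU).domain :=
    fun f => (mulCLM_mem_domain_and_commutator ha f).1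
  refine ⟨hdom, A + (C * ‖a‖ + ‖a‖ * C), fun f => ?_⟩
  -- split `D = D₀ + B`
  have e : diracD L U hU ⟨mulCLM a f, hdom f⟩ - mulCLM a (diracD L U hU f) =
      (diracD0 L ⟨mulCLM a f, hdom f⟩ - mulCLM a (diracD0 L f)) +
      ((diracD L U hU ⟨mulCLM a f, hdom f⟩ - diracD0 L ⟨mulCLM a f, hdom f⟩) -
        mulCLM a (diracD L U hU f - diracD0 L f)) := by
    rw [_root_.map_sub]; abel
  rw [e]
  have h1 := norm_diracD0_commutator_le ha f (hdom f)
  have h2 : ‖diracD L U hU ⟨mulCLM a f, hdom f⟩ - diracD0 L ⟨mulCLM a f, hdom f⟩‖ ≤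
      C * ‖a‖ * ‖(f : circleL2 L)‖ := by
    calc _ ≤ C * ‖mulCLM a (f : circleL2 L)‖ := hC ⟨mulCLM a f, hdom f⟩
      _ ≤ C * (‖a‖ * ‖(f : circleL2 L)‖) := by gcongr; exact norm_mulCLM_apply_le _ _
      _ = C * ‖a‖ * ‖(f : circleL2 L)‖ := by ring
  have h3 : ‖mulCLM a (diracD L U hU f - diracD0 L f)‖ ≤ ‖a‖ * C * ‖(f : circleL2 L)‖ := by
    calc _ ≤ ‖a‖ * ‖diracD L U hU f - diracD0 L f‖ := norm_mulCLM_apply_le _ _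
      _ ≤ ‖a‖ * (C * ‖(f : circleL2 L)‖) := by gcongr; exact hC f
      _ = ‖a‖ * C * ‖(f : circleL2 L)‖ := by ring
  calc _ ≤ ‖diracD0 L ⟨mulCLM a f, hdom f⟩ - mulCLM a (diracD0 L f)‖ +
        ‖(diracD L U hU ⟨mulCLM a f, hdom f⟩ - diracD0 L ⟨mulCLM a f, hdom f⟩) -
          mulCLM a (diracD L U hU f - diracD0 L f)‖ := norm_add_le _ _
    _ ≤ A * ‖(f : circleL2 L)‖ + (C * ‖a‖ * ‖(f : circleL2 L)‖ + ‖a‖ * C * ‖(f : circleL2 L)‖) :=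
        add_le_add h1 ((norm_sub_le _ _).trans (add_le_add h2 h3))
    _ = (A + (C * ‖a‖ + ‖a‖ * C)) * ‖(f : circleL2 L)‖ := by ring

/-- **Proposition 4.1, all three clauses**: `(𝒜(λ), ℋ(λ), D(λ,k))` is a spectral triple, for every
finite-dimensional `U ≤ dom D₀` in place of `range Π(λ,k)`. [cite: ConnesConsani2023, Prop. 4.1 (arXiv chunk p0013:L15–L17)] -/
theorem isSmoothSpectralTriple_diracD (hU : U ≤ (diracD0 L).domain) :
    IsSmoothSpectralTriple (diracD L U hU) :=
  isSmoothSpectralTriple_diracD_of_hasBoundedCommutator U hU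
    fun _ ha => hasBoundedCommutator_diracD U hU ha

end PerturbedCommutator

/-- DISCHARGE of the named fact `ConnesConsani2023_prop_4_1` (**Connes–Consani 2023, Prop. 4.1**:
"The operator `D(λ,k)`, combined with the action of periodic functions by multiplication in
`L²([−L/2,L/2])` defines a spectral triple"), proved as printed: finite-rank perturbation of the
standard Dirac operator `D₀ = −iu∂_u` (self-adjoint with compact resolvent, `[D₀, a] = −ia′`), bounded
symmetric perturbation (Kato–Rellich), finite-rank resolvent correction, bounded commutators. RH-FREE.
[cite: ConnesConsani2023, Prop. 4.1 (arXiv chunk p0013:L15–L17)] -/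
theorem ConnesConsani2023_prop_4_1_holds : ConnesConsani2023_prop_4_1 := by
  intro L _ U _ hU
  exact isSmoothSpectralTriple_diracD U hU

end ZetaCycles

end Literature.NumberTheory.ConnesConsani2023
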